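import Literature.Analysis.Complex.ArgumentPrincipleRectangle
import Literature.NumberTheory.LFunctions.LevinsonMontgomery
import HarnessLib

/-!
# Levinson–Montgomery's contour: the box identity `N₁(K) - N(K) = (1/2πi) ∮_{∂K} (ζ'/ζ)'/(ζ'/ζ)`

Trunk T-ANT (NumberTheory/LFunctions). Part D1 of the decomposition of `Literature.NumberTheory.LFunctions.speiser_iff`
along Levinson–Montgomery, Acta Math. 133 (1974), §2, proof of Theorem 1: "the change in
argument of `ζ'/ζ` around `R` is `2π(N₁(R) - N(R))`", where `N(R)`, `N₁(R)` count the zeros of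
`ζ`, `ζ'` in the rectangle `R` with multiplicity. Here `R = K = [0, b] × [t₁, t₂]` with
`0 < t₁ < t₂` (so `K` avoids the pole), `ζ ζ' ≠ 0` on `∂K`, and the statement is the difference
of the argument principle (`Literature.Analysis.Complex.integral_boundary_rect_logDeriv`) for `ζ'` and for `ζ`,
the integrand `(ζ'/ζ)'/(ζ'/ζ) = ζ''/ζ' - ζ'/ζ` being analytic on `∂K`.

Also: the vertical-edge form of "the variation of `arg g` on a segment where `Re g < 0` is less
than `π`", and the bookkeeping relating the box counts to Levinson–Montgomery's `N⁻(T)`,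
`N₁⁻(T)` (`Literature.NumberTheory.LFunctions.zetaLeftCount`, `derivZetaLeftCount`): if no zero of height `≤ T` has
abscissa in `[b, ½)` and none has height exactly `t₁` or in `[t₂, T)`, then
`N⁻(T) = N⁻(t₁) + N(K)` and likewise for `ζ'`.

Everything here is proved.

## Main results

* `Literature.NumberTheory.LFunctions.abs_im_integral_logDeriv_vertical_le_pi` — `|Im (i ∫_c^d g'/g(x+iy) dy)| ≤ π` if
  `Re g < 0` on the segment.
* `Literature.NumberTheory.LFunctions.analyticAt_logDeriv_riemannZeta`, `Literature.NumberTheory.LFunctions.logDeriv_logDeriv_riemannZeta`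
  (`(ζ'/ζ)'/(ζ'/ζ) = ζ''/ζ' - ζ'/ζ`).
* `Literature.RH.lmBoxZeta b t₁ t₂`, `Literature.RH.lmBoxDerivZeta b t₁ t₂` — the zeros of `ζ`, `ζ'` in the open
  box `(0,b) × (t₁,t₂)`; `lmBoxCount`, `lmBoxDerivCount` — their numbers with multiplicity (in `ℤ`).
* `Literature.NumberTheory.LFunctions.rectBoundaryIntegral_logDeriv_logDeriv_riemannZeta` — **the box identity**
  `∮_{∂K} (ζ'/ζ)'/(ζ'/ζ) = 2πi (N₁(K) - N(K))`.
* `Literature.NumberTheory.LFunctions.zetaLeftCount_eq_add_lmBoxCount`, `Literature.NumberTheory.LFunctions.derivZetaLeftCount_eq_add_lmBoxDerivCount` —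
  `N⁻(T) = N⁻(t₁) + N(K)`, `N₁⁻(T) = N₁⁻(t₁) + N₁(K)` under the separation hypotheses.

## References

* N. Levinson, H. L. Montgomery, *Zeros of the derivatives of the Riemann zeta-function*, Acta
  Math. 133 (1974), 49–65, §2.
* J. B. Conway, *Functions of One Complex Variable I*, 2nd ed., GTM 11, Ch. V Thm. 3.4.
-/

noncomputable section

open Complex Set MeasureTheory Filter Topology intervalIntegral
open scoped Real

namespace Literature.NumberTheory.LFunctions

/-! ## Vertical edges with `Re g < 0` -/

/-- On a vertical segment on which `g` is analytic with `Re g < 0`, the variation of `arg g` is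
less than `π`: `|Im (i ∫_c^d g'/g (x+iy) dy)| ≤ π` (principal `log(-g)` is a primitive).
[folklore] -/
theorem abs_im_integral_logDeriv_vertical_le_pi {g : ℂ → ℂ} {c d : ℝ} (x : ℝ) (hcd : c ≤ d)
    (hg : ∀ y ∈ Icc c d, AnalyticAt ℂ g (x + y * I))
    (hre : ∀ y ∈ Icc c d, (g (x + y * I)).re < 0) :
    |(I * ∫ y : ℝ in c..d, deriv g (x + y * I) / g (x + y * I)).im| ≤ π := by
  have key : ∀ z, AnalyticAt ℂ g z → deriv (fun w ↦ -g w) z / (-g z) = deriv g z / g z := by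
    intro z hz
    rw [deriv.fun_neg, neg_div_neg_eq]
  have hslit : ∀ y ∈ Icc c d, -g (x + y * I) ∈ slitPlane := fun y hy ↦
    Or.inl (by simpa using hre y hy)
  have h := Literature.Analysis.Complex.integral_logDeriv_vertical (g := fun w ↦ -g w) x hcd
    (fun y hy ↦ (hg y hy).neg) hslit
  rw [intervalIntegral.integral_congr (fun y hy ↦ key _ (hg y (by rwa [uIcc_of_le hcd] at hy)))]
    at h
  rw [h, sub_im, log_im, log_im]
  have h1 : |arg (-g (x + d * I))| < π / 2 :=
    abs_arg_lt_pi_div_two_iff.2 (Or.inl (by simpa using hre d ⟨hcd, le_rfl⟩))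
  have h2 : |arg (-g (x + c * I))| < π / 2 :=
    abs_arg_lt_pi_div_two_iff.2 (Or.inl (by simpa using hre c ⟨le_rfl, hcd⟩))
  rw [abs_lt] at h1 h2
  rw [abs_le]
  constructor <;> linarith

/-! ## The function `ζ'/ζ` and its logarithmic derivative -/

/-- `logDeriv ζ = ζ'/ζ` as functions. [folklore] -/
lemma logDeriv_riemannZeta_eq_div : logDeriv riemannZeta = fun s ↦ deriv riemannZeta s / riemannZeta s :=
  rfl

/-- `ζ'/ζ` is analytic at every `s ≠ 1` with `ζ(s) ≠ 0`. [folklore] -/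
theorem analyticAt_logDeriv_riemannZeta {s : ℂ} (hs1 : s ≠ 1) (hζ : riemannZeta s ≠ 0) :
    AnalyticAt ℂ (logDeriv riemannZeta) s := by
  rw [logDeriv_riemannZeta_eq_div]
  exact (analyticOnNhd_deriv_riemannZeta s hs1).div (analyticOn_riemannZeta s hs1) hζ

/-- **`(ζ'/ζ)'/(ζ'/ζ) = ζ''/ζ' - ζ'/ζ`** where `ζ ζ' ≠ 0` (logarithmic derivative of a quotient).
[folklore] -/
theorem logDeriv_logDeriv_riemannZeta {s : ℂ} (hs1 : s ≠ 1) (hζ : riemannZeta s ≠ 0)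
    (hζ' : deriv riemannZeta s ≠ 0) :
    deriv (logDeriv riemannZeta) s / logDeriv riemannZeta s =
      deriv (deriv riemannZeta) s / deriv riemannZeta s - deriv riemannZeta s / riemannZeta s := by
  have h : deriv (logDeriv riemannZeta) s / logDeriv riemannZeta s =
      logDeriv (logDeriv riemannZeta) s := (logDeriv_apply _ _).symm
  rw [h, logDeriv_riemannZeta_eq_div]
  have hd1 : DifferentiableAt ℂ (deriv riemannZeta) s :=
    (analyticOnNhd_deriv_riemannZeta s hs1).differentiableAt
  have hd0 : DifferentiableAt ℂ riemannZeta s := differentiableAt_riemannZeta hs1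
  rw [logDeriv_div s hζ' hζ hd1 hd0, logDeriv_apply, logDeriv_apply]

/-! ## The boxes and their zero counts -/

/-- The zeros of `ζ` in the open box `(0, b) × (t₁, t₂)`. [cite: LevinsonMontgomery1974, §2] -/
def lmBoxZeta (b t₁ t₂ : ℝ) : Set ℂ :=
  {ρ | riemannZeta ρ = 0 ∧ ρ ∈ Ioo 0 b ×ℂ Ioo t₁ t₂}

/-- The zeros of `ζ'` in the open box `(0, b) × (t₁, t₂)`. [cite: LevinsonMontgomery1974, §2] -/
def lmBoxDerivZeta (b t₁ t₂ : ℝ) : Set ℂ :=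
  {ρ | deriv riemannZeta ρ = 0 ∧ ρ ∈ Ioo 0 b ×ℂ Ioo t₁ t₂}

/-- `N(K)`: the number of zeros of `ζ` in the box, with multiplicity (in `ℤ`). [cite: LevinsonMontgomery1974, §2] -/
def lmBoxCount (b t₁ t₂ : ℝ) : ℤ :=
  ∑ᶠ ρ ∈ lmBoxZeta b t₁ t₂, Literature.NumberTheory.LFunctions.riemannZetaZeroOrder ρ

/-- `N₁(K)`: the number of zeros of `ζ'` in the box, with multiplicity (in `ℤ`). [cite: LevinsonMontgomery1974, §2] -/
def lmBoxDerivCount (b t₁ t₂ : ℝ) : ℤ :=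
  ∑ᶠ ρ ∈ lmBoxDerivZeta b t₁ t₂, derivRiemannZetaZeroOrder ρ

/-- The box zeros of `ζ` with `b ≤ ½`, `0 ≤ t₁` lie in `zetaLeftBox t₂`. [folklore] -/
lemma lmBoxZeta_subset {b t₁ t₂ : ℝ} (hb : b ≤ 1 / 2) (ht₁ : 0 ≤ t₁) :
    lmBoxZeta b t₁ t₂ ⊆ zetaLeftBox t₂ := by
  rintro ρ ⟨h0, ⟨h1, h2⟩, ⟨h3, h4⟩⟩
  exact ⟨h0, h1, lt_of_lt_of_le h2 hb, lt_of_le_of_lt ht₁ h3, h4⟩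

/-- The box zeros of `ζ'` with `b ≤ ½`, `0 ≤ t₁` lie in `derivZetaLeftBox t₂`. [folklore] -/
lemma lmBoxDerivZeta_subset {b t₁ t₂ : ℝ} (hb : b ≤ 1 / 2) (ht₁ : 0 ≤ t₁) :
    lmBoxDerivZeta b t₁ t₂ ⊆ derivZetaLeftBox t₂ := by
  rintro ρ ⟨h0, ⟨h1, h2⟩, ⟨h3, h4⟩⟩
  exact ⟨h0, h1, lt_of_lt_of_le h2 hb, lt_of_le_of_lt ht₁ h3, h4⟩

/-- The box zero sets are finite (`b ≤ ½`, `0 ≤ t₁`). [folklore] -/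
lemma lmBoxZeta_finite {b t₁ t₂ : ℝ} (hb : b ≤ 1 / 2) (ht₁ : 0 ≤ t₁) :
    (lmBoxZeta b t₁ t₂).Finite :=
  (zetaLeftBox_finite t₂).subset (lmBoxZeta_subset hb ht₁)

/-- The box zero sets are finite (`b ≤ ½`, `0 ≤ t₁`). [folklore] -/
lemma lmBoxDerivZeta_finite {b t₁ t₂ : ℝ} (hb : b ≤ 1 / 2) (ht₁ : 0 ≤ t₁) :
    (lmBoxDerivZeta b t₁ t₂).Finite :=
  (derivZetaLeftBox_finite t₂).subset (lmBoxDerivZeta_subset hb ht₁)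

/-! ## The box identity -/

/-- **The box identity** (Levinson–Montgomery §2: "the change in argument of `ζ'/ζ` around the
rectangle is `2π(N₁ - N)`"): for `K = [0,b] × [t₁,t₂]` with `0 < b`, `0 < t₁ < t₂` and
`ζ ζ' ≠ 0` on `∂K`,
`∮_{∂K} (ζ'/ζ)'/(ζ'/ζ) = 2πi (N₁(K) - N(K))` (four-term boundary convention
`Literature.Analysis.Complex.rectBoundaryIntegral`). Difference of the argument principle for `ζ'` and `ζ`.
[cite: LevinsonMontgomery1974, §2] -/
theorem rectBoundaryIntegral_logDeriv_logDeriv_riemannZeta {b t₁ t₂ : ℝ} (hb : 0 < b)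
    (ht₁ : 0 < t₁) (ht : t₁ < t₂)
    (h_bot : ∀ x ∈ Icc 0 b, riemannZeta (x + t₁ * I) ≠ 0 ∧ deriv riemannZeta (x + t₁ * I) ≠ 0)
    (h_top : ∀ x ∈ Icc 0 b, riemannZeta (x + t₂ * I) ≠ 0 ∧ deriv riemannZeta (x + t₂ * I) ≠ 0)
    (h_left : ∀ y ∈ Icc t₁ t₂, riemannZeta ((0 : ℝ) + y * I) ≠ 0 ∧
      deriv riemannZeta ((0 : ℝ) + y * I) ≠ 0)
    (h_right : ∀ y ∈ Icc t₁ t₂, riemannZeta (b + y * I) ≠ 0 ∧ deriv riemannZeta (b + y * I) ≠ 0) :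
    Literature.Analysis.Complex.rectBoundaryIntegral
        (fun z ↦ deriv (logDeriv riemannZeta) z / logDeriv riemannZeta z) 0 b t₁ t₂ =
      2 * π * I * (lmBoxDerivCount b t₁ t₂ - lmBoxCount b t₁ t₂ : ℤ) := by
  -- no point of the closed box is the pole
  have hne1 : ∀ z ∈ Icc 0 b ×ℂ Icc t₁ t₂, z ≠ 1 := by
    rintro z ⟨-, hz1, -⟩ rfl
    simp at hz1
    linarith
  have hne1' : ∀ {x y : ℝ}, y ∈ Icc t₁ t₂ → (x : ℂ) + y * I ≠ 1 := by
    intro x y hy h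
    have := congrArg Complex.im h
    simp at this
    linarith [hy.1]
  have hζan : AnalyticOnNhd ℂ riemannZeta (Icc 0 b ×ℂ Icc t₁ t₂) := fun z hz ↦
    analyticOn_riemannZeta z (hne1 z hz)
  have hζ'an : AnalyticOnNhd ℂ (deriv riemannZeta) (Icc 0 b ×ℂ Icc t₁ t₂) := fun z hz ↦
    analyticOnNhd_deriv_riemannZeta z (hne1 z hz)
  -- argument principle for `ζ` and `ζ'`
  have hAζ : Literature.Analysis.Complex.rectBoundaryIntegral (fun z ↦ deriv riemannZeta z / riemannZeta z)
      0 b t₁ t₂ = 2 * π * I * ∑ᶠ ρ ∈ {ρ : ℂ | riemannZeta ρ = 0 ∧ ρ ∈ Ioo 0 b ×ℂ Ioo t₁ t₂},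
        ((meromorphicOrderAt riemannZeta ρ).untop₀ : ℂ) := by
    rw [Literature.Analysis.Complex.rectBoundaryIntegral_def]
    exact_mod_cast Literature.Analysis.Complex.integral_boundary_rect_logDeriv hb ht hζan
      (fun x hx ↦ (h_bot x hx).1) (fun x hx ↦ (h_top x hx).1) (fun y hy ↦ (h_left y hy).1)
      (fun y hy ↦ (h_right y hy).1)
  have hAζ' : Literature.Analysis.Complex.rectBoundaryIntegral
      (fun z ↦ deriv (deriv riemannZeta) z / deriv riemannZeta z) 0 b t₁ t₂ =
      2 * π * I * ∑ᶠ ρ ∈ {ρ : ℂ | deriv riemannZeta ρ = 0 ∧ ρ ∈ Ioo 0 b ×ℂ Ioo t₁ t₂},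
        ((meromorphicOrderAt (deriv riemannZeta) ρ).untop₀ : ℂ) := by
    rw [Literature.Analysis.Complex.rectBoundaryIntegral_def]
    exact_mod_cast Literature.Analysis.Complex.integral_boundary_rect_logDeriv hb ht hζ'an
      (fun x hx ↦ (h_bot x hx).2) (fun x hx ↦ (h_top x hx).2) (fun y hy ↦ (h_left y hy).2)
      (fun y hy ↦ (h_right y hy).2)
  -- pointwise identity on the boundary and continuity there
  have hpt : ∀ {x y : ℝ}, y ∈ Icc t₁ t₂ → riemannZeta (x + y * I) ≠ 0 →
      deriv riemannZeta (x + y * I) ≠ 0 →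
      deriv (logDeriv riemannZeta) (x + y * I) / logDeriv riemannZeta (x + y * I) =
        deriv (deriv riemannZeta) (x + y * I) / deriv riemannZeta (x + y * I) +
          -(deriv riemannZeta (x + y * I) / riemannZeta (x + y * I)) :=
    fun hy h0 h1 ↦ by rw [logDeriv_logDeriv_riemannZeta (hne1' hy) h0 h1, sub_eq_add_neg]
  have hc1 : ∀ {x y : ℝ}, y ∈ Icc t₁ t₂ → deriv riemannZeta (x + y * I) ≠ 0 →
      ContinuousAt (fun z ↦ deriv (deriv riemannZeta) z / deriv riemannZeta z) (x + y * I) := by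
    intro x y hy h1
    have ha : AnalyticAt ℂ (deriv riemannZeta) (x + y * I) :=
      analyticOnNhd_deriv_riemannZeta _ (hne1' hy)
    exact ha.deriv.continuousAt.div ha.continuousAt h1
  have hc0 : ∀ {x y : ℝ}, y ∈ Icc t₁ t₂ → riemannZeta (x + y * I) ≠ 0 →
      ContinuousAt (fun z ↦ -(deriv riemannZeta z / riemannZeta z)) (x + y * I) := by
    intro x y hy h0
    have ha : AnalyticAt ℂ riemannZeta (x + y * I) := analyticOn_riemannZeta _ (hne1' hy)
    exact (ha.deriv.continuousAt.div ha.continuousAt h0).neg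
  have ht₁m : t₁ ∈ Icc t₁ t₂ := ⟨le_rfl, ht.le⟩
  have ht₂m : t₂ ∈ Icc t₁ t₂ := ⟨ht.le, le_rfl⟩
  rw [Literature.Analysis.Complex.rectBoundaryIntegral_congr
      (G := fun z ↦ deriv (deriv riemannZeta) z / deriv riemannZeta z +
        -(deriv riemannZeta z / riemannZeta z)) hb.le ht.le
      (fun x hx ↦ hpt ht₁m (h_bot x hx).1 (h_bot x hx).2)
      (fun x hx ↦ hpt ht₂m (h_top x hx).1 (h_top x hx).2)
      (fun y hy ↦ hpt hy (h_left y hy).1 (h_left y hy).2)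
      (fun y hy ↦ hpt hy (h_right y hy).1 (h_right y hy).2),
    Literature.Analysis.Complex.rectBoundaryIntegral_add hb.le ht.le
      (fun x hx ↦ hc1 ht₁m (h_bot x hx).2) (fun x hx ↦ hc1 ht₂m (h_top x hx).2)
      (fun y hy ↦ hc1 hy (h_left y hy).2) (fun y hy ↦ hc1 hy (h_right y hy).2)
      (fun x hx ↦ hc0 ht₁m (h_bot x hx).1) (fun x hx ↦ hc0 ht₂m (h_top x hx).1)
      (fun y hy ↦ hc0 hy (h_left y hy).1) (fun y hy ↦ hc0 hy (h_right y hy).1),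
    show (fun z ↦ -(deriv riemannZeta z / riemannZeta z)) =
      fun z ↦ (-1 : ℂ) * (deriv riemannZeta z / riemannZeta z) from by funext z; ring,
    Literature.Analysis.Complex.rectBoundaryIntegral_const_mul, hAζ, hAζ']
  -- identify the finsums with the integer counts
  have hcorner : ((0 : ℝ) : ℂ) + (t₁ : ℂ) * I ∈ Icc 0 b ×ℂ Icc t₁ t₂ :=
    ⟨by simpa using hb.le, by simpa using ht.le⟩
  have hfin0 := Literature.Analysis.Complex.finite_zeros_reProdIm hb.le ht.le hζan hcorner
    (h_bot 0 ⟨le_rfl, hb.le⟩).1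
  have hfin1 := Literature.Analysis.Complex.finite_zeros_reProdIm hb.le ht.le hζ'an hcorner
    (h_bot 0 ⟨le_rfl, hb.le⟩).2
  rw [lmBoxDerivCount, lmBoxCount, lmBoxDerivZeta, lmBoxZeta,
    finsum_mem_eq_finite_toFinset_sum _ hfin0, finsum_mem_eq_finite_toFinset_sum _ hfin1,
    finsum_mem_eq_finite_toFinset_sum _ hfin0, finsum_mem_eq_finite_toFinset_sum _ hfin1]
  simp only [Literature.NumberTheory.LFunctions.riemannZetaZeroOrder, derivRiemannZetaZeroOrder]
  push_cast
  ring

/-! ## From box counts to `N⁻(T)`, `N₁⁻(T)` -/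

/-- `N⁻(T)` as an integer: the finsum of the orders (which is non-negative). [folklore] -/
theorem zetaLeftCount_int (T : ℝ) :
    (zetaLeftCount T : ℤ) = ∑ᶠ ρ ∈ zetaLeftBox T, Literature.NumberTheory.LFunctions.riemannZetaZeroOrder ρ := by
  rw [zetaLeftCount, Int.toNat_of_nonneg]
  rw [finsum_mem_eq_finite_toFinset_sum _ (zetaLeftBox_finite T)]
  refine Finset.sum_nonneg fun ρ hρ ↦ Literature.NumberTheory.LFunctions.riemannZetaZeroOrder_nonneg ?_
  rw [Set.Finite.mem_toFinset] at hρ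
  rintro rfl
  norm_num [zetaLeftBox] at hρ

/-- `N₁⁻(T)` as an integer. [folklore] -/
theorem derivZetaLeftCount_int (T : ℝ) :
    (derivZetaLeftCount T : ℤ) = ∑ᶠ ρ ∈ derivZetaLeftBox T, derivRiemannZetaZeroOrder ρ := by
  rw [derivZetaLeftCount, Int.toNat_of_nonneg]
  rw [finsum_mem_eq_finite_toFinset_sum _ (derivZetaLeftBox_finite T)]
  refine Finset.sum_nonneg fun ρ hρ ↦ derivRiemannZetaZeroOrder_nonneg ?_
  rw [Set.Finite.mem_toFinset] at hρ
  rintro rfl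
  norm_num [derivZetaLeftBox] at hρ

/-- **`N⁻(T) = N⁻(t₁) + N(K)`** for `K = (0,b) × (t₁,t₂)`, provided no zero of `ζ` with
`0 < β < ½`, `0 < γ < T` has height exactly `t₁`, and those above `t₁` have `β < b` and
`γ < t₂` (`b ≤ ½`, `0 < t₁ ≤ t₂ ≤ T`). [folklore] -/
theorem zetaLeftCount_eq_add_lmBoxCount {b t₁ t₂ T : ℝ} (hb : b ≤ 1 / 2) (ht₁ : 0 < t₁)
    (ht₁₂ : t₁ ≤ t₂) (ht₂T : t₂ ≤ T)
    (hsep : ∀ ρ ∈ zetaLeftBox T, ρ.im ≠ t₁ ∧ (t₁ < ρ.im → ρ.re < b ∧ ρ.im < t₂)) :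
    (zetaLeftCount T : ℤ) = zetaLeftCount t₁ + lmBoxCount b t₁ t₂ := by
  have hunion : zetaLeftBox T = zetaLeftBox t₁ ∪ lmBoxZeta b t₁ t₂ := by
    ext ρ
    constructor
    · intro hρ
      obtain ⟨hne, habove⟩ := hsep ρ hρ
      obtain ⟨h0, h1, h2, h3, h4⟩ := hρ
      rcases lt_or_gt_of_ne hne with hlt | hgt
      · exact Or.inl ⟨h0, h1, h2, h3, hlt⟩
      · obtain ⟨hre, him⟩ := habove hgt
        exact Or.inr ⟨h0, ⟨h1, hre⟩, ⟨hgt, him⟩⟩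
    · rintro (⟨h0, h1, h2, h3, h4⟩ | hρ)
      · exact ⟨h0, h1, h2, h3, by linarith⟩
      · obtain ⟨h0, h1, h2, h3, h4⟩ := lmBoxZeta_subset hb ht₁.le hρ
        exact ⟨h0, h1, h2, h3, by linarith⟩
  have hdisj : Disjoint (zetaLeftBox t₁) (lmBoxZeta b t₁ t₂) := by
    rw [Set.disjoint_left]
    rintro ρ ⟨-, -, -, -, h4⟩ ⟨-, -, h5, -⟩
    linarith
  rw [zetaLeftCount_int, zetaLeftCount_int, lmBoxCount, hunion,
    finsum_mem_union hdisj (zetaLeftBox_finite t₁) (lmBoxZeta_finite hb ht₁.le)]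

/-- **`N₁⁻(T) = N₁⁻(t₁) + N₁(K)`** under the analogous separation hypotheses for the zeros of
`ζ'`. [folklore] -/
theorem derivZetaLeftCount_eq_add_lmBoxDerivCount {b t₁ t₂ T : ℝ} (hb : b ≤ 1 / 2)
    (ht₁ : 0 < t₁) (ht₁₂ : t₁ ≤ t₂) (ht₂T : t₂ ≤ T)
    (hsep : ∀ ρ ∈ derivZetaLeftBox T, ρ.im ≠ t₁ ∧ (t₁ < ρ.im → ρ.re < b ∧ ρ.im < t₂)) :
    (derivZetaLeftCount T : ℤ) = derivZetaLeftCount t₁ + lmBoxDerivCount b t₁ t₂ := by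
  have hunion : derivZetaLeftBox T = derivZetaLeftBox t₁ ∪ lmBoxDerivZeta b t₁ t₂ := by
    ext ρ
    constructor
    · intro hρ
      obtain ⟨hne, habove⟩ := hsep ρ hρ
      obtain ⟨h0, h1, h2, h3, h4⟩ := hρ
      rcases lt_or_gt_of_ne hne with hlt | hgt
      · exact Or.inl ⟨h0, h1, h2, h3, hlt⟩
      · obtain ⟨hre, him⟩ := habove hgt
        exact Or.inr ⟨h0, ⟨h1, hre⟩, ⟨hgt, him⟩⟩
    · rintro (⟨h0, h1, h2, h3, h4⟩ | hρ)
      · exact ⟨h0, h1, h2, h3, by linarith⟩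
      · obtain ⟨h0, h1, h2, h3, h4⟩ := lmBoxDerivZeta_subset hb ht₁.le hρ
        exact ⟨h0, h1, h2, h3, by linarith⟩
  have hdisj : Disjoint (derivZetaLeftBox t₁) (lmBoxDerivZeta b t₁ t₂) := by
    rw [Set.disjoint_left]
    rintro ρ ⟨-, -, -, -, h4⟩ ⟨-, -, h5, -⟩
    linarith
  rw [derivZetaLeftCount_int, derivZetaLeftCount_int, lmBoxDerivCount, hunion,
    finsum_mem_union hdisj (derivZetaLeftBox_finite t₁) (lmBoxDerivZeta_finite hb ht₁.le)]

/-- A zero of `ζ` in `R_T` contributes at least `1` to `N⁻(T)`; more generally `N⁻(T)` is at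
least the number of elements of any finite set of zeros in `R_T`. [folklore] -/
theorem card_le_zetaLeftCount {T : ℝ} (S : Finset ℂ) (hS : ∀ ρ ∈ S, ρ ∈ zetaLeftBox T) :
    (S.card : ℤ) ≤ zetaLeftCount T := by
  rw [zetaLeftCount_int, finsum_mem_eq_finite_toFinset_sum _ (zetaLeftBox_finite T)]
  have hne1 : ∀ ρ ∈ zetaLeftBox T, ρ ≠ 1 := by
    rintro ρ ⟨-, -, h2, -, -⟩ rfl
    norm_num at h2
  calc (S.card : ℤ) = ∑ ρ ∈ S, (1 : ℤ) := by simp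
    _ ≤ ∑ ρ ∈ S, Literature.NumberTheory.LFunctions.riemannZetaZeroOrder ρ := Finset.sum_le_sum fun ρ hρ ↦ by
        have h := hS ρ hρ
        have := (Literature.NumberTheory.LFunctions.riemannZetaZeroOrder_pos_iff (hne1 ρ h)).2 h.1
        omega
    _ ≤ ∑ ρ ∈ (zetaLeftBox_finite T).toFinset, Literature.NumberTheory.LFunctions.riemannZetaZeroOrder ρ := by
        apply Finset.sum_le_sum_of_subset_of_nonneg
        · intro ρ hρ
          rw [Set.Finite.mem_toFinset]
          exact hS ρ hρ
        · intro ρ hρ _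
          rw [Set.Finite.mem_toFinset] at hρ
          exact Literature.NumberTheory.LFunctions.riemannZetaZeroOrder_nonneg (hne1 ρ hρ)

end Literature.NumberTheory.LFunctions

end
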